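import Summits.ResolutionOfSingularities.ResolutionOfSingularities.Theorems.UniversalCellsCampaignW82RegularTwistLinks
import Summits.ResolutionOfSingularities.ResolutionOfSingularities.Theorems.UniversalCellsCampaignW82KunzTwistCriterion
import Summits.ResolutionOfSingularities.ResolutionOfSingularities.Theorems.UniversalCellsCampaignW82FrobeniusTwistCalculus
import Summits.ResolutionOfSingularities.ResolutionOfSingularities.Theorems.UniversalCellsCampaignW82FrobeniusTwistRungs
import HarnessLib

/-!
# [OURS · L1 W8.2] The regular-twist criterion serves DOOR 2 as well: the door-2 graded residuals
# (`PerfectionStepAlgClosedDimLe`, `PerfectionStepAlgClosureFgDimLe`) in regularity-only / eventual form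

Cell `res-hironaka` (run/shared/lean/pub/res-hironaka/), LADDER-RESOLUTION rung L (RESCUE), slot W8.2; host route
`UniversalCells`, host item `PrimeFieldToPerfect` (stmt-ResolutionOfSingularities-15233, door 1); the statements
named here are the slot's DOOR-2 graded residuals (…SmoothTwistGraded / …FrobeniusTwistRungs, supporting
`UniformComplexity.PrimeModelTransfer`, stmt-ResolutionOfSingularities-8933). Theses-free links leaf written by
res-L1-s82-pv-1 (gen 5): an algebraically closed constant field is perfect (Mathlib instance
`IsAlgClosed.perfectField`), so `frobeniusTwistStepAt_iff_regularTwistStep` (…RegularTwistLinks) and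
`frobeniusTwistStepAt_iff_eventually_regularPair` (…FrobeniusTwistCalculus) apply verbatim to door 2's constant fields.

* `perfectionStepAlgClosedDimLe_iff_forall_regularTwistStep` — door 2, v1: for all algebraically closed `M` of
  characteristic `p`, the residual at `(M, n)` in REGULARITY-ONLY form (a level `e` and a proper birational model of
  `X₀^{(p^e)}` over `M(t)` whose next twist is regular).
* `perfectionStepAlgClosureFgDimLe_iff_forall_regularTwistStep` — door 2, sharpest form (`M = (closure s)^{alg} ∩ K`).
* `perfectionStepAlgClosedDimLe_iff_forall_eventually_regularPair` — door 2, v1, «for all large `e`, a RESOLUTION of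
  `X₀^{(p^e)}` with regular next twist».

HONEST FRAMING. OURS theorems about OURS statements (role replaced: §17 ¶2 p.89 l.59–62 of [Hironaka2017], typed AS
PRINTED as `S17Methodology.U89_3`); NOT statements of the manuscript; pure instantiation, not progress on either
door's open residual. AI work, weaker than expert review; no claim beyond the kernel.
-/

noncomputable section

set_option linter.dupNamespace false -- mandated namespace of this single-conjunct summit

open CategoryTheory CategoryTheory.Limits AlgebraicGeometry TopologicalSpace
open Literature.AlgebraicGeometry.Resolution

namespace Summit.ResolutionOfSingularities.ResolutionOfSingularities.Theorems.CampaignW82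

/-- **Door 2 (v1) in regularity-only form**: `PerfectionStepAlgClosedDimLe p n` iff for every algebraically closed
`M` of characteristic `p`, under `Res_{≤ n}(M(t))`, every admissible `X₀` over `M(t)` has a level `e` and a proper
birational model `Y → X₀^{(p^e)}` whose Frobenius twist `Y^{(p)}` is regular. [cite: EGAIV2, Prop. 6.7.4] -/
theorem perfectionStepAlgClosedDimLe_iff_forall_regularTwistStep (p : ℕ) [Fact p.Prime] (n : WithBot ℕ∞) :
    PerfectionStepAlgClosedDimLe p n ↔
      ∀ (M : Type) [Field M] [CharP M p] [IsAlgClosed M],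
        ((∀ (X : Scheme.{0}) (f : X ⟶ Spec (.of (RatFunc M))),
            IsSeparated f → LocallyOfFiniteType f → QuasiCompact f → IsIntegral X →
              topologicalKrullDim X ≤ n → Scheme.HasResolution X) →
          ∀ (X₀ : Scheme.{0}) (f₀ : X₀ ⟶ Spec (.of (RatFunc M))),
            IsSeparated f₀ → LocallyOfFiniteType f₀ → QuasiCompact f₀ → topologicalKrullDim X₀ ≤ n →
              IntegralOverPerfectClosure (RatFunc M) f₀ →
                ∃ (e : ℕ) (Y : Scheme.{0})
                  (π : Y ⟶ pullback f₀ (Spec.map (CommRingCat.ofHom (iterateFrobenius (RatFunc M) p e)))),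
                  IsProper π ∧ IsBirational π ∧
                    Scheme.IsRegular (pullback
                      (π ≫ pullback.snd f₀ (Spec.map (CommRingCat.ofHom (iterateFrobenius (RatFunc M) p e))))
                      (Spec.map (CommRingCat.ofHom (frobenius (RatFunc M) p))))) := by
  rw [perfectionStepAlgClosedDimLe_iff_forall_frobeniusTwistStepAt]
  refine forall_congr' fun M => forall_congr' fun _ => forall_congr' fun _ => forall_congr' fun _ => ?_
  exact frobeniusTwistStepAt_iff_regularTwistStep p M n

/-- **Door 2 (sharpest form) in regularity-only form**: the same at the constant fields
`M = (closure s)^{alg} ∩ K` (`K` algebraically closed of characteristic `p`, `s ⊂ K` finite), which are algebraically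
closed (Mathlib `algebraicClosure.isAlgClosure`), hence perfect. [cite: EGAIV2, Prop. 6.7.4] -/
theorem perfectionStepAlgClosureFgDimLe_iff_forall_regularTwistStep (p : ℕ) [Fact p.Prime] (n : WithBot ℕ∞) :
    PerfectionStepAlgClosureFgDimLe p n ↔
      ∀ (K : Type) [Field K] [CharP K p] [IsAlgClosed K] (s : Finset K),
        ((∀ (X : Scheme.{0}) (f : X ⟶ Spec (.of (RatFunc (algebraicClosure (Subfield.closure (↑s : Set K)) K)))),
            IsSeparated f → LocallyOfFiniteType f → QuasiCompact f → IsIntegral X →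
              topologicalKrullDim X ≤ n → Scheme.HasResolution X) →
          ∀ (X₀ : Scheme.{0}) (f₀ : X₀ ⟶ Spec (.of (RatFunc (algebraicClosure (Subfield.closure (↑s : Set K)) K)))),
            IsSeparated f₀ → LocallyOfFiniteType f₀ → QuasiCompact f₀ → topologicalKrullDim X₀ ≤ n →
              IntegralOverPerfectClosure (RatFunc (algebraicClosure (Subfield.closure (↑s : Set K)) K)) f₀ →
                ∃ (e : ℕ) (Y : Scheme.{0})
                  (π : Y ⟶ pullback f₀ (Spec.map (CommRingCat.ofHom
                    (iterateFrobenius (RatFunc (algebraicClosure (Subfield.closure (↑s : Set K)) K)) p e)))),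
                  IsProper π ∧ IsBirational π ∧
                    Scheme.IsRegular (pullback
                      (π ≫ pullback.snd f₀ (Spec.map (CommRingCat.ofHom
                        (iterateFrobenius (RatFunc (algebraicClosure (Subfield.closure (↑s : Set K)) K)) p e))))
                      (Spec.map (CommRingCat.ofHom
                        (frobenius (RatFunc (algebraicClosure (Subfield.closure (↑s : Set K)) K)) p))))) := by
  rw [perfectionStepAlgClosureFgDimLe_iff_forall_frobeniusTwistStepAt]
  refine forall_congr' fun K => forall_congr' fun _ => forall_congr' fun _ => forall_congr' fun _ =>
    forall_congr' fun s => ?_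
  haveI : IsAlgClosed (algebraicClosure (Subfield.closure (↑s : Set K)) K) :=
    IsAlgClosure.isAlgClosed (Subfield.closure (↑s : Set K))
  exact frobeniusTwistStepAt_iff_regularTwistStep p _ n

/-- **Door 2 (v1), eventually and with a regular pair**: for every algebraically closed `M` of characteristic `p`,
under `Res_{≤ n}(M(t))`, every admissible `X₀` has FOR ALL LARGE `e` a resolution `Y → X₀^{(p^e)}` (`Y` regular)
whose next twist is regular. [cite: EGAIV2, Prop. 6.7.4] -/
theorem perfectionStepAlgClosedDimLe_iff_forall_eventually_regularPair (p : ℕ) [Fact p.Prime] (n : WithBot ℕ∞) :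
    PerfectionStepAlgClosedDimLe p n ↔
      ∀ (M : Type) [Field M] [CharP M p] [IsAlgClosed M],
        ((∀ (X : Scheme.{0}) (f : X ⟶ Spec (.of (RatFunc M))),
            IsSeparated f → LocallyOfFiniteType f → QuasiCompact f → IsIntegral X →
              topologicalKrullDim X ≤ n → Scheme.HasResolution X) →
          ∀ (X₀ : Scheme.{0}) (f₀ : X₀ ⟶ Spec (.of (RatFunc M))),
            IsSeparated f₀ → LocallyOfFiniteType f₀ → QuasiCompact f₀ → topologicalKrullDim X₀ ≤ n →
              IntegralOverPerfectClosure (RatFunc M) f₀ →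
                ∃ e₀ : ℕ, ∀ e : ℕ, e₀ ≤ e →
                  ∃ (Y : Scheme.{0})
                    (π : Y ⟶ pullback f₀ (Spec.map (CommRingCat.ofHom (iterateFrobenius (RatFunc M) p e)))),
                    IsProper π ∧ IsBirational π ∧ Scheme.IsRegular Y ∧
                      Scheme.IsRegular (pullback
                        (π ≫ pullback.snd f₀ (Spec.map (CommRingCat.ofHom (iterateFrobenius (RatFunc M) p e))))
                        (Spec.map (CommRingCat.ofHom (frobenius (RatFunc M) p))))) := by
  rw [perfectionStepAlgClosedDimLe_iff_forall_frobeniusTwistStepAt]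
  refine forall_congr' fun M => forall_congr' fun _ => forall_congr' fun _ => forall_congr' fun _ => ?_
  exact frobeniusTwistStepAt_iff_eventually_regularPair p M n

end Summit.ResolutionOfSingularities.ResolutionOfSingularities.Theorems.CampaignW82

end
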